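import Literature.NumberTheory.Sieve.MaynardSimplexIntegrals
import Mathlib.Analysis.SpecialFunctions.Integrals.Basic
import HarnessLib

/-!
# The panel Beta-integral identity `∫_{1/ρ}^{1} (1−x)^i x² (1−ρx)^j dx` in closed form

LINE 1 — FRAMING: RH-FREE elementary calculus (Euler's Beta integral at natural arguments and two
substitutions); cell rh-crit, corpus C1, seat t12 g2, Tier-2 analysis support (cc-lead R107 (3) /
R109 (4)) for the (E-a) kernel certificate of `CC2021_section6_enclosures` — piece (P2) of cc-iso g4's
design of record (cc/STATUS.md 2026-08-26T11:26:00Z, step (T2b): "the integral term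
`∫_{1/ρ}^1 xψ′(x)·ρxη̃′(ρx)dx` in CLOSED FORM by Beta integrals after `x = 1 − w`").  bears_on: W-C/W-P
(K3 stmt `WindowSpectralBound`, item 19306).  WHAT THIS IS NOT: a certificate, an enclosure, or any
claim about RH — nothing here bears on the truth of RH.

Source of the one classical input: Euler's Beta integral at natural arguments,
`∫₀¹ s^p (1−s)^q ds = p! q!/(p+q+1)!` — the TREE theorem
`Literature.NumberTheory.Sieve.MaynardTao.integral_pow_mul_one_sub_pow` [cite: MaynardAnnals2015, proof
of Lemma 7.1 (beta function identity)], imported, not restated; A. Jeffrey, *Handbook of Mathematical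
Formulas and Integrals* (1995) [bib `Jeffrey1995`], §11.1.7.1 (the Beta function,
`B(x,y) = ∫₀¹ t^{x−1}(1−t)^{y−1} dt = Γ(x)Γ(y)/Γ(x+y)`, p0143:L67–L76).

## What is here (theorems only: 0 definitions, 0 named facts)

* `integral_pow_mul_sub_pow (u) (p q) : ∫₀^u w^p (u − w)^q dw = u^{p+q+1} · p! q!/(p+q+1)!`
  (scaling `w = u s`; all real `u`);
* **`integral_panel_beta (hρ : ρ ≠ 0) (i j) :
    ∫_{ρ⁻¹}^{1} (1−x)^i · x² · (1−ρx)^j dx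
      = (−1)^j ρ^j · (u^{i+j+1} β(i,j) − 2 u^{i+j+2} β(i+1,j) + u^{i+j+3} β(i+2,j))`**,
  `u = 1 − ρ⁻¹`, `β(p,q) = p! q!/(p+q+1)!` written out (cc-iso's display: `x = 1 − w`,
  `1 − ρx = −ρ(u − w)`, `(1 − w)² = 1 − 2w + w²`); cancellation-free for `ρ ∈ [1,2]` (`u ∈ [0,½]`);
* `integral_panel_beta_weighted` — the `ρ`-weighted integrand `x(1−x)^i·ρx(1−ρx)^j` (factor `ρ^{j+1}`);
* `integral_panel_beta_sum` — the double finite sum over coefficient families `f_i`, `b_j` (the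
  shape of the (T2b) display `Σ_{i,j} f_i b_j (−1)^j ρ^{j+1}[…]`);
* `beta_factorial_zero_right` / `beta_factorial_succ_right` / `beta_factorial_succ_left` — the values
  `β(i,j) = i!j!/(i+j+1)!` by recurrence (`β(i,0) = 1/(i+1)`, `β(i,j+1) = β(i,j)(j+1)/(i+j+2)`), the
  factorial-free form a kernel certificate tabulates.
-/

noncomputable section

open Real MeasureTheory Set intervalIntegral
open scoped Nat

namespace Literature.Analysis.SpecialFunctions

open Literature.NumberTheory.Sieve.MaynardTao

/-- **Shifted Beta integral**: `∫₀^u w^p (u − w)^q dw = u^{p+q+1} · p! q!/(p+q+1)!` for every real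
`u` (substitution `w = u·s` and Euler's Beta integral at natural arguments).
[cite: Jeffrey1995, §11.1.7.1 (Beta function) (p0143:L67–L76); MaynardAnnals2015, proof of Lemma 7.1 (beta function identity)] -/
theorem integral_pow_mul_sub_pow (u : ℝ) (p q : ℕ) :
    ∫ w in (0 : ℝ)..u, w ^ p * (u - w) ^ q = u ^ (p + q + 1) * ((p ! * q ! : ℝ) / (p + q + 1)!) := by
  have h : u • ∫ s in (0 : ℝ)..1, (u * s) ^ p * (u - u * s) ^ q =
      ∫ w in u * 0..u * 1, w ^ p * (u - w) ^ q :=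
    intervalIntegral.smul_integral_comp_mul_left (fun w : ℝ ↦ w ^ p * (u - w) ^ q) u
  simp only [mul_zero, mul_one, smul_eq_mul] at h
  rw [← h, ← integral_pow_mul_one_sub_pow p q, ← intervalIntegral.integral_const_mul,
    ← intervalIntegral.integral_const_mul]
  refine intervalIntegral.integral_congr fun s _ ↦ ?_
  rw [show u - u * s = u * (1 - s) by ring, mul_pow, mul_pow]
  ring

/-- **The panel Beta-integral identity** (piece (P2) of the (E-a) Tier-2 design): for `ρ ≠ 0`,
`u = 1 − ρ⁻¹` and natural `i, j`,
`∫_{ρ⁻¹}^{1} (1−x)^i x² (1−ρx)^j dx = (−1)^j ρ^j (u^{i+j+1}β(i,j) − 2u^{i+j+2}β(i+1,j) + u^{i+j+3}β(i+2,j))`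
with `β(p,q) = p! q!/(p+q+1)!` (substitution `x = 1 − w`, `1 − ρx = −ρ(u − w)`, expansion of `(1−w)²`,
and `integral_pow_mul_sub_pow`).
[cite: Jeffrey1995, §11.1.7.1 (Beta function) (p0143:L67–L76); ConnesConsani2021, §6.3–6.4 p. 24 (the kernel `ϖ` whose panel enclosure this serves)] -/
theorem integral_panel_beta {ρ : ℝ} (hρ : ρ ≠ 0) (i j : ℕ) :
    ∫ x in ρ⁻¹..(1 : ℝ), (1 - x) ^ i * x ^ 2 * (1 - ρ * x) ^ j =
      (-1) ^ j * ρ ^ j *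
        ((1 - ρ⁻¹) ^ (i + j + 1) * ((i ! * j ! : ℝ) / (i + j + 1)!) -
          2 * (1 - ρ⁻¹) ^ (i + j + 2) * (((i + 1)! * j ! : ℝ) / (i + 1 + j + 1)!) +
          (1 - ρ⁻¹) ^ (i + j + 3) * (((i + 2)! * j ! : ℝ) / (i + 2 + j + 1)!)) := by
  set u : ℝ := 1 - ρ⁻¹ with hu
  -- substitution `x = 1 − w`
  have hsub := intervalIntegral.integral_comp_sub_left
    (fun x : ℝ ↦ (1 - x) ^ i * x ^ 2 * (1 - ρ * x) ^ j) (a := (0 : ℝ)) (b := u) 1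
  rw [sub_zero, show (1 : ℝ) - u = ρ⁻¹ by rw [hu]; ring] at hsub
  rw [← hsub]
  -- the integrand in `w`
  have hint : ∀ w : ℝ, (1 - (1 - w)) ^ i * (1 - w) ^ 2 * (1 - ρ * (1 - w)) ^ j =
      (-1) ^ j * ρ ^ j * (w ^ i * (u - w) ^ j - 2 * (w ^ (i + 1) * (u - w) ^ j) +
        w ^ (i + 2) * (u - w) ^ j) := by
    intro w
    have h1 : 1 - ρ * (1 - w) = -ρ * (u - w) := by
      rw [hu]; field_simp; ring
    rw [sub_sub_cancel, h1, mul_pow, neg_pow ρ]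
    ring
  simp_rw [hint]
  rw [intervalIntegral.integral_const_mul, intervalIntegral.integral_add, intervalIntegral.integral_sub,
    intervalIntegral.integral_const_mul, integral_pow_mul_sub_pow, integral_pow_mul_sub_pow,
    integral_pow_mul_sub_pow]
  · ring_nf
  all_goals exact Continuous.intervalIntegrable (by fun_prop) _ _

/-- **The `ρ`-weighted form used in (T2b)**: the integrand `x·(1−x)^i · ρx·(1−ρx)^j` of
`∫_{1/ρ}^1 xψ′(x)·ρxη̃′(ρx) dx` (one term of the double series) integrates to
`(−1)^j ρ^{j+1} (u^{i+j+1}β(i,j) − 2u^{i+j+2}β(i+1,j) + u^{i+j+3}β(i+2,j))`.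
[cite: Jeffrey1995, §11.1.7.1 (Beta function) (p0143:L67–L76); ConnesConsani2021, §6.3–6.4 p. 24] -/
theorem integral_panel_beta_weighted {ρ : ℝ} (hρ : ρ ≠ 0) (i j : ℕ) :
    ∫ x in ρ⁻¹..(1 : ℝ), x * (1 - x) ^ i * (ρ * x) * (1 - ρ * x) ^ j =
      (-1) ^ j * ρ ^ (j + 1) *
        ((1 - ρ⁻¹) ^ (i + j + 1) * ((i ! * j ! : ℝ) / (i + j + 1)!) -
          2 * (1 - ρ⁻¹) ^ (i + j + 2) * (((i + 1)! * j ! : ℝ) / (i + 1 + j + 1)!) +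
          (1 - ρ⁻¹) ^ (i + j + 3) * (((i + 2)! * j ! : ℝ) / (i + 2 + j + 1)!)) := by
  have h : ∀ x : ℝ, x * (1 - x) ^ i * (ρ * x) * (1 - ρ * x) ^ j =
      ρ * ((1 - x) ^ i * x ^ 2 * (1 - ρ * x) ^ j) := fun x ↦ by ring
  simp_rw [h]
  rw [intervalIntegral.integral_const_mul, integral_panel_beta hρ]
  ring

/-- **The double-series form used in (T2b)**: for finite coefficient families `f` (inner, degree
`< K`) and `b` (outer, degree `< K'`),
`∫_{1/ρ}^1 x·(Σ_{i<K} f_i (1−x)^i) · ρx·(Σ_{j<K'} b_j (1−ρx)^j) dx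
  = Σ_{i<K} Σ_{j<K'} f_i b_j (−1)^j ρ^{j+1} (u^{i+j+1}β(i,j) − 2u^{i+j+2}β(i+1,j) + u^{i+j+3}β(i+2,j))`
(linearity + `integral_panel_beta_weighted`).
[cite: Jeffrey1995, §11.1.7.1 (Beta function) (p0143:L67–L76); ConnesConsani2021, §6.3–6.4 p. 24] -/
theorem integral_panel_beta_sum {ρ : ℝ} (hρ : ρ ≠ 0) (f b : ℕ → ℝ) (K K' : ℕ) :
    ∫ x in ρ⁻¹..(1 : ℝ), x * (∑ i ∈ Finset.range K, f i * (1 - x) ^ i) * (ρ * x) *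
        (∑ j ∈ Finset.range K', b j * (1 - ρ * x) ^ j) =
      ∑ i ∈ Finset.range K, ∑ j ∈ Finset.range K', f i * b j * ((-1) ^ j * ρ ^ (j + 1) *
        ((1 - ρ⁻¹) ^ (i + j + 1) * ((i ! * j ! : ℝ) / (i + j + 1)!) -
          2 * (1 - ρ⁻¹) ^ (i + j + 2) * (((i + 1)! * j ! : ℝ) / (i + 1 + j + 1)!) +
          (1 - ρ⁻¹) ^ (i + j + 3) * (((i + 2)! * j ! : ℝ) / (i + 2 + j + 1)!))) := by
  have hexp : ∀ x : ℝ, x * (∑ i ∈ Finset.range K, f i * (1 - x) ^ i) * (ρ * x) *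
      (∑ j ∈ Finset.range K', b j * (1 - ρ * x) ^ j) =
      ∑ i ∈ Finset.range K, ∑ j ∈ Finset.range K',
        f i * b j * (x * (1 - x) ^ i * (ρ * x) * (1 - ρ * x) ^ j) := by
    intro x
    rw [show x * (∑ i ∈ Finset.range K, f i * (1 - x) ^ i) * (ρ * x) *
        (∑ j ∈ Finset.range K', b j * (1 - ρ * x) ^ j) = (x * (ρ * x)) *
        ((∑ i ∈ Finset.range K, f i * (1 - x) ^ i) * (∑ j ∈ Finset.range K', b j * (1 - ρ * x) ^ j))
        by ring, Finset.sum_mul_sum, Finset.mul_sum]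
    refine Finset.sum_congr rfl fun i _ ↦ ?_
    rw [Finset.mul_sum]
    refine Finset.sum_congr rfl fun j _ ↦ ?_
    ring
  simp_rw [hexp]
  rw [intervalIntegral.integral_finsetSum (fun i _ ↦ ?_)]
  · refine Finset.sum_congr rfl fun i _ ↦ ?_
    rw [intervalIntegral.integral_finsetSum (fun j _ ↦ ?_)]
    · refine Finset.sum_congr rfl fun j _ ↦ ?_
      rw [intervalIntegral.integral_const_mul, integral_panel_beta_weighted hρ]
    · exact Continuous.intervalIntegrable (by fun_prop) _ _
  · exact Continuous.intervalIntegrable (by fun_prop) _ _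

/-! ## The factorial Beta values by recurrence (no factorials in the kernel)

`β(i,j) = i! j!/(i+j+1)!` satisfies `β(i,0) = 1/(i+1)` and `β(i,j+1) = β(i,j)·(j+1)/(i+j+2)` — the form in
which a kernel certificate tabulates them. -/

/-- `β(i,0) = 1/(i+1)`. [cite: Jeffrey1995, §11.1.7.1 (Beta function) (p0143:L67–L76)] -/
theorem beta_factorial_zero_right (i : ℕ) :
    ((i ! * (0)! : ℝ) / (i + 0 + 1)!) = 1 / (i + 1) := by
  rw [Nat.factorial_zero, Nat.cast_one, mul_one, add_zero, Nat.factorial_succ, Nat.cast_mul]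
  have hi : (i ! : ℝ) ≠ 0 := by positivity
  field_simp
  push_cast
  ring

/-- `β(i,j+1) = β(i,j)·(j+1)/(i+j+2)`. [cite: Jeffrey1995, §11.1.7.1 (Beta function) (p0143:L67–L76)] -/
theorem beta_factorial_succ_right (i j : ℕ) :
    ((i ! * (j + 1)! : ℝ) / (i + (j + 1) + 1)!) =
      ((i ! * j ! : ℝ) / (i + j + 1)!) * ((j + 1 : ℝ) / (i + j + 2)) := by
  have h1 : ((i + (j + 1) + 1)! : ℝ) = (i + j + 2 : ℝ) * (i + j + 1)! := by
    rw [show i + (j + 1) + 1 = (i + j + 1) + 1 by ring, Nat.factorial_succ]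
    push_cast
    ring
  rw [Nat.factorial_succ j, h1]
  have hf : ((i + j + 1)! : ℝ) ≠ 0 := by positivity
  have h2 : (i + j + 2 : ℝ) ≠ 0 := by positivity
  push_cast
  field_simp

/-- The same recurrence in the first index (symmetry): `β(i+1,j) = β(i,j)·(i+1)/(i+j+2)`.
[cite: Jeffrey1995, §11.1.7.1 (Beta function, B(x,y) = B(y,x)) (p0143:L79)] -/
theorem beta_factorial_succ_left (i j : ℕ) :
    (((i + 1)! * j ! : ℝ) / (i + 1 + j + 1)!) =
      ((i ! * j ! : ℝ) / (i + j + 1)!) * ((i + 1 : ℝ) / (i + j + 2)) := by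
  have h1 : ((i + 1 + j + 1)! : ℝ) = (i + j + 2 : ℝ) * (i + j + 1)! := by
    rw [show i + 1 + j + 1 = (i + j + 1) + 1 by ring, Nat.factorial_succ]
    push_cast
    ring
  rw [Nat.factorial_succ i, h1]
  have hf : ((i + j + 1)! : ℝ) ≠ 0 := by positivity
  have h2 : (i + j + 2 : ℝ) ≠ 0 := by positivity
  push_cast
  field_simp

end Literature.Analysis.SpecialFunctions

end
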